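import Literature.IUT.HodgeTheaters.InitialThetaDataLocalPuncturedData
import HarnessLib

/-!
# [IUTchI] Definition 3.1 (e)/(f): transporting the §1 constructions of the LOCAL datum `D.peLoc k ι` into
# `Π_{C_F} × Gal(Ω/k)` — the geometric side is unchanged by base change

S. Mochizuki, *Inter-universal Teichmüller theory I*, §3, Def. 3.1 (e), (f) (kurims manuscript, May 2020, pp. 62–63)
[claim: Mochizuki2012, status: disputed]: (e) "for each `v̲ ∈ V(K)`, we shall use the subscript `v̲` to denote the result
of base-changing hyperbolic orbicurves over `F` or `K` to `K_v̲` … natural cartesian diagrams … `Δ_X → Π_{X̲_v̲} → Π_{X_v}`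
…"; §1 pp. 37–38 (the constructions `Δ_{X̲} ↠ Δ_{X̲}^{ab} ⊗ ℤ/l ↠ Δ_ε ↠ Δ_ε⁺`, i.e. `modLKer ≤ deltaEpsKer ≤ jKer`).

PROOF-ONLY sequel, part 1 of 2 (theorems only; no definitions, no instances), of `InitialThetaDataLocalPuncturedData`
(abc-iut-L5-t2, p421799: the §1 datum `D.peLoc k ι : PuncturedEllipticData` of the local core `C_v̲ := C_K ×_K K_v̲`,
ambient `Π_{C_v̲} := Π_{C_K} ×_{G_F} Gal(Ω/k)`). Writing `T := Subgroup.map (Π_{C_v̲}).subtype` (subgroups of the local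
ambient group viewed in `Π_{C_F} × Gal(Ω/k)`) and `e := D.embLoc k : Π_{C_K} → Π_{C_F} × Gal(Ω/k)`, `y ↦ (embK y, 1)`
(both CLOSED embeddings — `isClosedEmbedding_subtype_PiLoc_PiCK`, `isClosedEmbedding_embLoc`; on `Δ_{C_K}` the latter is
the injection "`Δ_C → Π_{C_v̲}`" of Def. 3.1 (e)):
* generic transport (`PuncturedEllipticData.map_*_eq`, any datum, any injective / closed-embedding `φ`): images of
  abc-iut-L5-t1's §1 constructions `Δ_{X̲}, Δ_{C̲}, I_x, modLKer, deltaEpsKer, jKer, galKer, Π_{X→}, Π_{C→}` under `φ`;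
* base change inside `Π_{C_F} × Γ` (`PiLoc_inf`, `map_subtype_comap_fstLoc`, `map_subtype_ker_augLoc`, and the
  `e`-lemmas `map_embLoc_eq_prod`, `PiLoc_map_inf_map_embLoc_deltaC` = "`(embK M)_v̲ ∩ e(Δ_{C_K}) = e(M ∩ Δ_{C_K})`");
* the ARITHMETIC side base-changes: `T(Π_{X,v̲}) = Π_{X_K} ×_{G_F} Gal(Ω/k)`, `T(Π_{C̲,v̲}) = Π_{C̲_K} ×_{G_F} Gal(Ω/k)`,
  `T(D_{x,v̲}) = D_x ×_{G_F} Gal(Ω/k)` (`map_subtype_peLoc_PiX/PiCbar/decomp`);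
* the GEOMETRIC side is unchanged: `T(Δ_{C,v̲}) = e(Δ_{C_K})`, `T(Δ_{X̲,v̲}) = e(Δ_{X̲})`, `T(Δ_{C̲,v̲}) = e(Δ_{C̲})`,
  `T(I_{x,v̲}) = e(I_x)`, `T(modLKer_v̲) = e(modLKer)`, `T(deltaEpsKer_v̲) = e(deltaEpsKer)`
  (`map_subtype_peLoc_deltaC/deltaXbar/deltaCbar/inertia/modLKer/deltaEpsKer`).
Part 2 (`InitialThetaDataLocalArrowProofs`) finishes with `jKer`, `galKer` and the comparison of `Π_{X̲→}(C_v̲)` (Def. 1.1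
run locally) with `Π_v̲ := Π_{X̲→_K} ×_{G_F} Gal(Ω/k)`. The local datum's subgroups live in `Π_{C_v̲}` with the group
structure of the construction (`Subgroup.map (G := (D.peLoc k ι).PiC)` pins that reading; it is the subtype
`Π_{C_v̲} ⊆ Π_{C_F} × Gal(Ω/k)` definitionally). Nothing of the series is asserted; no side is taken.
-/

noncomputable section

namespace Literature.IUT.HodgeTheaters

open Topology

universe u v w w'

namespace InitialThetaData

/-! ### Two transport lemmas (pure topology / group theory) -/

/-- A closed embedding of topological groups commutes with topological closures of subgroups.
[claim: Mochizuki2012, status: disputed] -/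
theorem map_topologicalClosure_eq_of_isClosedEmbedding {G H : Type*} [Group G] [TopologicalSpace G]
    [IsTopologicalGroup G] [Group H] [TopologicalSpace H] [IsTopologicalGroup H] (f : G →* H)
    (hf : IsClosedEmbedding f) (S : Subgroup G) :
    S.topologicalClosure.map f = (S.map f).topologicalClosure := by
  apply SetLike.coe_injective
  rw [Subgroup.coe_map, Subgroup.topologicalClosure_coe, Subgroup.topologicalClosure_coe, Subgroup.coe_map,
    hf.closure_image_eq]

/-- A homomorphism commutes with "the set of `n`-th powers of a subset". [claim: Mochizuki2012, status: disputed] -/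
theorem image_pow_image {G H : Type*} [Monoid G] [Monoid H] (f : G →* H) (n : ℕ) (S : Set G) :
    f '' ((fun y : G => y ^ n) '' S) = (fun y : H => y ^ n) '' (f '' S) := by
  simp only [Set.image_image, map_pow]

/-- Transport of the commutator set `{x c x⁻¹ c⁻¹ | x ∈ X, c ∈ Y ∖ X}` along two injective homomorphisms with the
same images of `X`, `Y` (one inclusion; apply twice). [claim: Mochizuki2012, status: disputed] -/
theorem image_commSet_subset {A B C : Type*} [Group A] [Group B] [Group C] (f : A →* C) (g : B →* C)
    (hf : Function.Injective f) (X₁ Y₁ : Subgroup A) (X₂ Y₂ : Subgroup B)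
    (hX : X₁.map f = X₂.map g) (hY : Y₁.map f = Y₂.map g) :
    f '' {z : A | ∃ x ∈ X₁, ∃ c ∈ Y₁, c ∉ X₁ ∧ z = x * c * x⁻¹ * c⁻¹} ⊆
      g '' {z : B | ∃ x ∈ X₂, ∃ c ∈ Y₂, c ∉ X₂ ∧ z = x * c * x⁻¹ * c⁻¹} := by
  rintro _ ⟨z, ⟨x, hx, c, hc, hcX, rfl⟩, rfl⟩
  have hx' : f x ∈ X₂.map g := by rw [← hX]; exact Subgroup.mem_map_of_mem f hx
  have hc' : f c ∈ Y₂.map g := by rw [← hY]; exact Subgroup.mem_map_of_mem f hc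
  obtain ⟨x₂, hx₂, hx₂e⟩ := hx'
  obtain ⟨c₂, hc₂, hc₂e⟩ := hc'
  refine ⟨x₂ * c₂ * x₂⁻¹ * c₂⁻¹, ⟨x₂, hx₂, c₂, hc₂, ?_, rfl⟩, ?_⟩
  · intro hc₂X
    have : f c ∈ X₁.map f := by rw [hX]; exact ⟨c₂, hc₂X, hc₂e⟩
    obtain ⟨c', hc', hc'e⟩ := this
    exact hcX (hf hc'e ▸ hc')
  · simp only [map_mul, map_inv, hx₂e, hc₂e]

/-! ### Base change of subgroups of `Π_{C_K}` inside `Π_{C_F} × Γ` -/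

section General

variable {F : Type u} {K : Type v} {Fbar : Type w} [Field F] [NumberField F] [Field K] [NumberField K]
  [Algebra F K] [Field Fbar] [Algebra F Fbar] [Algebra K Fbar]
  {E : WeierstrassCurve F} [E.IsElliptic] {l : ℕ} {Pb : BadPlacePredicates K}
  (D : InitialThetaData F K Fbar E l Pb) {Γ : Type w'} [Group Γ] (ρ : Γ →* (Fbar ≃ₐ[F] Fbar))

/-- Base change commutes with intersections: `(H ∩ H')_v̲ = H_v̲ ∩ H'_v̲`. [claim: Mochizuki2012, status: disputed] -/
theorem PiLoc_inf (H H' : Subgroup D.PiC) : D.PiLoc (H ⊓ H') ρ = D.PiLoc H ρ ⊓ D.PiLoc H' ρ := by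
  ext z
  simp only [mem_PiLoc, Subgroup.mem_inf]
  tauto

/-- **Subgroups of the local ambient group `Π_{H₀,v̲}` pulled back from `Π_{C_F}` are base changes**: for
`H, H₀ ⊆ Π_{C_F}`, the preimage of `H` under `Π_{H₀,v̲} → Π_{C_F}`, viewed in `Π_{C_F} × Γ`, is `(H ∩ H₀)_v̲`.
[claim: Mochizuki2012, status: disputed] -/
theorem map_subtype_comap_fstLoc (H H₀ : Subgroup D.PiC) :
    (H.comap (D.fstLoc H₀ ρ)).map (D.PiLoc H₀ ρ).subtype = D.PiLoc (H ⊓ H₀) ρ := by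
  ext z
  constructor
  · rintro ⟨w, hw, rfl⟩
    have hw' := (D.mem_PiLoc H₀ ρ w.1).mp w.2
    exact (D.mem_PiLoc _ ρ _).mpr ⟨Subgroup.mem_inf.mpr ⟨hw, hw'.1⟩, hw'.2⟩
  · intro hz
    obtain ⟨hz1, hz2⟩ := (D.mem_PiLoc _ ρ z).mp hz
    obtain ⟨hzH, hzH₀⟩ := Subgroup.mem_inf.mp hz1
    exact ⟨⟨z, (D.mem_PiLoc H₀ ρ z).mpr ⟨hzH₀, hz2⟩⟩, hzH, rfl⟩

/-- The kernel of `Π_{H₀,v̲} ↠ Γ`, viewed in `Π_{C_F} × Γ`, is `(H₀ ∩ Δ_C) × 1`. [claim: Mochizuki2012, status: disputed] -/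
theorem map_subtype_ker_augLoc (H₀ : Subgroup D.PiC) :
    ((D.augLoc H₀ ρ).ker).map (D.PiLoc H₀ ρ).subtype =
      (H₀ ⊓ D.DeltaC).prod (⊥ : Subgroup Γ) := by
  ext z
  constructor
  · rintro ⟨w, hw, rfl⟩
    have hw' := (D.mem_PiLoc H₀ ρ w.1).mp w.2
    have h2 : w.1.2 = 1 := (D.mem_ker_augLoc H₀ ρ w).mp hw
    refine Subgroup.mem_prod.mpr ⟨Subgroup.mem_inf.mpr ⟨hw'.1, (D.augGF_eq_one_iff _).mp ?_⟩, ?_⟩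
    · change D.augGF w.1.1 = 1
      rw [hw'.2, h2, map_one]
    · exact Subgroup.mem_bot.mpr h2
  · intro hz
    obtain ⟨hz1, hz2⟩ := Subgroup.mem_prod.mp hz
    obtain ⟨hzH, hzΔ⟩ := Subgroup.mem_inf.mp hz1
    have h2 : z.2 = 1 := Subgroup.mem_bot.mp hz2
    refine ⟨⟨z, (D.mem_PiLoc H₀ ρ z).mpr ⟨hzH, ?_⟩⟩, (D.mem_ker_augLoc H₀ ρ _).mpr h2, rfl⟩
    rw [h2, map_one, (D.augGF_eq_one_iff _).mpr hzΔ]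

end General

/-! ### The injection `e : Π_{C_K} → Π_{C_F} × Gal(Ω/k)`, `y ↦ (embK y, 1)` -/

section Emb

variable {F : Type u} {K : Type v} {Fbar : Type w} [Field F] [NumberField F] [Field K] [NumberField K]
  [Algebra F K] [Field Fbar] [Algebra F Fbar] [Algebra K Fbar]
  {E : WeierstrassCurve F} [E.IsElliptic] {l : ℕ} {Pb : BadPlacePredicates K}
  (D : InitialThetaData F K Fbar E l Pb) {Ω : Type w} [Field Ω] (k : Type w) [Field k] [Algebra k Ω]
  (ρ : (Ω ≃ₐ[k] Ω) →* (Fbar ≃ₐ[F] Fbar))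

/-- `e` is injective (`embK` is). [claim: Mochizuki2012, status: disputed] -/
theorem embLoc_injective : Function.Injective (D.embLoc (Ω := Ω) k) := fun x y h => by
  have := congrArg Prod.fst h
  rw [embLoc_apply, embLoc_apply] at this
  exact D.geom.embK_injective this

/-- `e(M) = embK(M) × 1` for `M ⊆ Π_{C_K}`. [claim: Mochizuki2012, status: disputed] -/
theorem map_embLoc_eq_prod (M : Subgroup D.geom.pe.PiC) :
    M.map (D.embLoc (Ω := Ω) k) = (M.map D.geom.embK).prod (⊥ : Subgroup (Ω ≃ₐ[k] Ω)) := by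
  ext z
  constructor
  · rintro ⟨y, hy, rfl⟩
    rw [embLoc_apply]
    exact Subgroup.mem_prod.mpr ⟨⟨y, hy, rfl⟩, Subgroup.mem_bot.mpr rfl⟩
  · intro hz
    obtain ⟨⟨y, hy, hye⟩, hz2⟩ := Subgroup.mem_prod.mp hz
    refine ⟨y, hy, ?_⟩
    rw [embLoc_apply]
    exact Prod.ext hye (Subgroup.mem_bot.mp hz2).symm

/-- **The geometric side is unchanged by base change**: for `M ⊆ Π_{C_K}`,
`(embK(M))_v̲ ∩ e(Δ_{C_K}) = e(M ∩ Δ_{C_K})`. [claim: Mochizuki2012, status: disputed] -/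
theorem PiLoc_map_inf_map_embLoc_deltaC (M : Subgroup D.geom.pe.PiC) :
    D.PiLoc (M.map D.geom.embK) ρ ⊓ D.geom.pe.DeltaC.map (D.embLoc k) =
      (M ⊓ D.geom.pe.DeltaC).map (D.embLoc k) := by
  ext z
  constructor
  · intro hz
    obtain ⟨hz1, hz2⟩ := Subgroup.mem_inf.mp hz
    obtain ⟨y, hyΔ, rfl⟩ := hz2
    obtain ⟨⟨y', hy', hye⟩, -⟩ := (D.mem_PiLoc _ ρ _).mp hz1
    rw [embLoc_apply] at hye
    have hyy : y' = y := D.geom.embK_injective hye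
    subst hyy
    exact ⟨y', Subgroup.mem_inf.mpr ⟨hy', hyΔ⟩, rfl⟩
  · rintro ⟨y, hy, rfl⟩
    obtain ⟨hyM, hyΔ⟩ := Subgroup.mem_inf.mp hy
    refine Subgroup.mem_inf.mpr ⟨(D.mem_PiLoc _ ρ _).mpr ⟨?_, ?_⟩, ⟨y, hyΔ, rfl⟩⟩
    · rw [embLoc_apply]; exact ⟨y, hyM, rfl⟩
    · rw [embLoc_apply, map_one, D.augGF_eq_one_iff]
      exact (D.embK_mem_deltaC_iff y).mpr hyΔ

/-- For `M ⊆ Δ_{C_K}`: `e(M) ⊆ (embK(M))_v̲` (the inclusion "`Δ → Π_v̲`"). [claim: Mochizuki2012, status: disputed] -/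
theorem map_embLoc_le_PiLoc {M : Subgroup D.geom.pe.PiC} (hM : M ≤ D.geom.pe.DeltaC) :
    M.map (D.embLoc k) ≤ D.PiLoc (M.map D.geom.embK) ρ := by
  rintro _ ⟨y, hy, rfl⟩
  refine (D.mem_PiLoc _ ρ _).mpr ⟨?_, ?_⟩
  · rw [embLoc_apply]; exact ⟨y, hy, rfl⟩
  · rw [embLoc_apply, map_one, D.augGF_eq_one_iff]
    exact (D.embK_mem_deltaC_iff y).mpr (hM hy)

/-- `(H₀ ∩ Δ_C) × 1 = e(embK⁻¹(H₀) ∩ Δ_{C_K})` when `H₀ ⊆ Π_{C_K}` — the kernel of `Π_{H₀,v̲} ↠ Γ` is geometric.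
[claim: Mochizuki2012, status: disputed] -/
theorem prod_bot_eq_map_embLoc {H₀ : Subgroup D.PiC} (hH₀ : H₀ ≤ D.PiCK) :
    (H₀ ⊓ D.DeltaC).prod (⊥ : Subgroup (Ω ≃ₐ[k] Ω)) =
      (H₀.comap D.geom.embK ⊓ D.geom.pe.DeltaC).map (D.embLoc k) := by
  rw [map_embLoc_eq_prod]
  congr 1
  ext x
  constructor
  · intro hx
    obtain ⟨hxH, hxΔ⟩ := Subgroup.mem_inf.mp hx
    obtain ⟨y, rfl⟩ := hH₀ hxH
    exact ⟨y, Subgroup.mem_inf.mpr ⟨hxH, (D.embK_mem_deltaC_iff y).mp hxΔ⟩, rfl⟩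
  · rintro ⟨y, hy, rfl⟩
    obtain ⟨hyH, hyΔ⟩ := Subgroup.mem_inf.mp hy
    exact Subgroup.mem_inf.mpr ⟨hyH, (D.embK_mem_deltaC_iff y).mpr hyΔ⟩

end Emb

end InitialThetaData

/-! ### Images of the Definition 1.1 constructions under an (injective / closed) homomorphism -/

namespace PuncturedEllipticData

universe u'

variable (D' : PuncturedEllipticData.{u'}) {H : Type*} [Group H] (φ : D'.PiC →* H)

/-- `φ(Δ_{X̲}) = φ(Π_X) ∩ φ(Π_{C̲}) ∩ φ(Δ_C)` for injective `φ`. [claim: Mochizuki2012, status: disputed] -/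
theorem map_deltaXbar_eq (hφ : Function.Injective φ) :
    D'.DeltaXbar.map φ = D'.PiX.map φ ⊓ D'.PiCbar.map φ ⊓ D'.DeltaC.map φ := by
  rw [DeltaXbar, PiXbar, Subgroup.map_inf_eq _ _ _ hφ, Subgroup.map_inf_eq _ _ _ hφ]

/-- `φ(Δ_{C̲}) = φ(Π_{C̲}) ∩ φ(Δ_C)` for injective `φ`. [claim: Mochizuki2012, status: disputed] -/
theorem map_deltaCbar_eq (hφ : Function.Injective φ) :
    D'.DeltaCbar.map φ = D'.PiCbar.map φ ⊓ D'.DeltaC.map φ := by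
  rw [DeltaCbar, Subgroup.map_inf_eq _ _ _ hφ]

/-- `φ(I_x) = φ(D_x) ∩ φ(Δ_C)` for injective `φ`. [claim: Mochizuki2012, status: disputed] -/
theorem map_inertia_eq (hφ : Function.Injective φ) (c : D'.Cusp) :
    (D'.inertia c).map φ = (D'.decomp c).map φ ⊓ D'.DeltaC.map φ := by
  rw [inertia, Subgroup.map_inf_eq _ _ _ hφ]

/-- `φ(modLKer) = (⁅φΔ_{X̲}, φΔ_{X̲}⁆ · (φΔ_{X̲})^l)‾` for a closed embedding `φ` of topological groups.
[claim: Mochizuki2012, status: disputed] -/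
theorem map_modLKer_of_isClosedEmbedding [TopologicalSpace H] [IsTopologicalGroup H]
    (hφ : IsClosedEmbedding φ) :
    D'.modLKer.map φ = (⁅D'.DeltaXbar.map φ, D'.DeltaXbar.map φ⁆ ⊔
      Subgroup.closure ((fun y : H => y ^ D'.l) '' (D'.DeltaXbar.map φ : Set H))).topologicalClosure := by
  rw [modLKer, InitialThetaData.map_topologicalClosure_eq_of_isClosedEmbedding φ hφ, Subgroup.map_sup,
    Subgroup.map_commutator, MonoidHom.map_closure, InitialThetaData.image_pow_image, ← Subgroup.coe_map]

/-- `φ(deltaEpsKer) = φ(modLKer) · ∏ φ(I_x)` (`x` nonzero, `≠ ε′, ε″`). [claim: Mochizuki2012, status: disputed] -/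
theorem map_deltaEpsKer_eq : D'.deltaEpsKer.map φ = D'.modLKer.map φ ⊔
    ⨆ x : {x : D'.Cusp // D'.IsNonzeroCusp x ∧ x ≠ D'.ε1 ∧ x ≠ D'.ε2}, (D'.inertia x.1).map φ := by
  rw [deltaEpsKer, Subgroup.map_sup, Subgroup.map_iSup]

/-- `φ(jKer) = φ(deltaEpsKer) · ⟨φ of the ι-commutators⟩`. [claim: Mochizuki2012, status: disputed] -/
theorem map_jKer_eq : D'.jKer.map φ = D'.deltaEpsKer.map φ ⊔ Subgroup.closure (φ ''
    {z : D'.PiC | ∃ x ∈ D'.DeltaXbar, ∃ c ∈ D'.DeltaCbar, c ∉ D'.DeltaXbar ∧ z = x * c * x⁻¹ * c⁻¹}) := by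
  rw [jKer, Subgroup.map_sup, MonoidHom.map_closure]

/-- `φ(galKer) = φ(jKer) · ⟨(φΔ_{C̲})^l⟩`. [claim: Mochizuki2012, status: disputed] -/
theorem map_galKer_eq : D'.galKer.map φ = D'.jKer.map φ ⊔
    Subgroup.closure ((fun y : H => y ^ D'.l) '' (D'.DeltaCbar.map φ : Set H)) := by
  rw [galKer, Subgroup.map_sup, MonoidHom.map_closure, InitialThetaData.image_pow_image, ← Subgroup.coe_map]

/-- `φ(Π_{X→}) = φ(D_{2ε}) · φ(jKer)`. [claim: Mochizuki2012, status: disputed] -/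
theorem map_piXarrow_eq : D'.piXarrow.map φ = (D'.decomp D'.twoε).map φ ⊔ D'.jKer.map φ := by
  rw [piXarrow, Subgroup.map_sup]

/-- `φ(Π_{C→}) = φ(D_{2ε}) · φ(galKer)`. [claim: Mochizuki2012, status: disputed] -/
theorem map_piCarrow_eq : D'.piCarrow.map φ = (D'.decomp D'.twoε).map φ ⊔ D'.galKer.map φ := by
  rw [piCarrow, Subgroup.map_sup]

end PuncturedEllipticData

namespace InitialThetaData

/-! ### Definition 1.1 run on the local §1 datum `D.peLoc k ι`: the transport `T` -/

section PeLoc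

variable {F : Type u} {K : Type v} {Fbar : Type w} [Field F] [NumberField F] [Field K] [NumberField K]
  [Algebra F K] [Field Fbar] [Algebra F Fbar] [Algebra K Fbar] [IsScalarTower F K Fbar] [Normal K Fbar]
  [Algebra.IsIntegral F Fbar]
  {E : WeierstrassCurve F} [E.IsElliptic] {l : ℕ} {Pb : BadPlacePredicates K}
  (D : InitialThetaData F K Fbar E l Pb)
  {Ω : Type w} [Field Ω] [Algebra K Ω]
  (k : Type w) [Field k] [Algebra K k] [Algebra k Ω] [IsScalarTower K k Ω] [IsGalois k Ω] (ι : Fbar →ₐ[K] Ω)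

omit [IsGalois k Ω] in
/-- `Π_{C_v̲} ⊆ Π_{C_F} × Gal(Ω/k)` is a CLOSED embedding (so closures inside `Π_{C_v̲}` are closures in the product).
[claim: Mochizuki2012, status: disputed] -/
theorem isClosedEmbedding_subtype_PiLoc_PiCK :
    IsClosedEmbedding ((D.PiLoc D.PiCK (localToGF F k ι)).subtype) :=
  (D.isClosed_PiLoc_of_isClosed D.PiCK (localToGF F k ι) (D.PiCK.isClosed_of_isOpen D.isOpen_PiCK)
    (continuous_localToGF F k ι)).isClosedEmbedding_subtypeVal

omit [IsScalarTower F K Fbar] [Normal K Fbar] [Algebra.IsIntegral F Fbar] [Algebra K Ω] [Algebra K k]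
  [IsScalarTower K k Ω] in
/-- `e : Π_{C_K} → Π_{C_F} × Gal(Ω/k)`, `y ↦ (embK y, 1)`, is a CLOSED embedding (continuous injection of a profinite
group into a Hausdorff group). [claim: Mochizuki2012, status: disputed] -/
theorem isClosedEmbedding_embLoc : IsClosedEmbedding (D.embLoc (Ω := Ω) k) :=
  (D.continuous_embLoc k).isClosedEmbedding (D.embLoc_injective k)

/-! #### The arithmetic side base-changes -/

/-- `T(Π_{X,v̲}) = Π_{X_K} ×_{G_F} Gal(Ω/k)` (`Π_{X,v̲}` of the local datum is the preimage of `Π_{X_F}`).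
[claim: Mochizuki2012, status: disputed] -/
theorem map_subtype_peLoc_PiX :
    Subgroup.map (G := (D.peLoc k ι).PiC) (D.PiLoc D.PiCK (localToGF F k ι)).subtype (D.peLoc k ι).PiX =
      D.PiLoc D.PiXK (localToGF F k ι) := by
  show (D.geom.PiX.comap (D.fstLoc D.PiCK (localToGF F k ι))).map (D.PiLoc D.PiCK (localToGF F k ι)).subtype = _
  rw [map_subtype_comap_fstLoc]
  rfl

/-- `T(Π_{X,v̲}) = (embK Π_X)_v̲` (`Π_{X_K} = Π_{X_F} ∩ Π_{C_K}` is the image of `Π_X`, field `embK_PiX`).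
[claim: Mochizuki2012, status: disputed] -/
theorem map_subtype_peLoc_PiX' :
    Subgroup.map (G := (D.peLoc k ι).PiC) (D.PiLoc D.PiCK (localToGF F k ι)).subtype (D.peLoc k ι).PiX =
      D.PiLoc (D.geom.pe.PiX.map D.geom.embK) (localToGF F k ι) := by
  rw [map_subtype_peLoc_PiX, D.geom.embK_PiX]
  rfl

/-- `T(Π_{C̲,v̲}) = Π_{C̲_K} ×_{G_F} Gal(Ω/k)`. [claim: Mochizuki2012, status: disputed] -/
theorem map_subtype_peLoc_PiCbar :
    Subgroup.map (G := (D.peLoc k ι).PiC) (D.PiLoc D.PiCK (localToGF F k ι)).subtype (D.peLoc k ι).PiCbar =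
      D.PiLoc D.PiCund (localToGF F k ι) := by
  show (D.PiCund.comap (D.fstLoc D.PiCK (localToGF F k ι))).map (D.PiLoc D.PiCK (localToGF F k ι)).subtype = _
  rw [map_subtype_comap_fstLoc, inf_eq_left.mpr (show D.PiCund ≤ D.PiCK from Subgroup.map_le_range _ _)]

/-- `T(D_{x,v̲}) = D_x ×_{G_F} Gal(Ω/k)` (the local decomposition groups are the base changes of the global ones).
[claim: Mochizuki2012, status: disputed] -/
theorem map_subtype_peLoc_decomp (c : (D.peLoc k ι).Cusp) :
    Subgroup.map (G := (D.peLoc k ι).PiC) (D.PiLoc D.PiCK (localToGF F k ι)).subtype ((D.peLoc k ι).decomp c) =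
      D.PiLoc ((D.geom.pe.decomp c).map D.geom.embK) (localToGF F k ι) := by
  show (((D.geom.pe.decomp c).map D.geom.embK).comap (D.fstLoc D.PiCK (localToGF F k ι))).map
    (D.PiLoc D.PiCK (localToGF F k ι)).subtype = _
  rw [map_subtype_comap_fstLoc,
    inf_eq_left.mpr (show (D.geom.pe.decomp c).map D.geom.embK ≤ D.PiCK from Subgroup.map_le_range _ _)]

/-! #### The geometric side is unchanged -/

/-- `T(Δ_{C,v̲}) = e(Δ_{C_K})` — "`Δ_C → Π_{C_v̲}`" is an isomorphism onto the kernel of `Π_{C_v̲} ↠ Gal(Ω/k)`.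
[claim: Mochizuki2012, status: disputed] -/
theorem map_subtype_peLoc_deltaC :
    Subgroup.map (G := (D.peLoc k ι).PiC) (D.PiLoc D.PiCK (localToGF F k ι)).subtype (D.peLoc k ι).DeltaC =
      D.geom.pe.DeltaC.map (D.embLoc k) := by
  show ((D.augLoc D.PiCK (localToGF F k ι)).ker).map (D.PiLoc D.PiCK (localToGF F k ι)).subtype = _
  rw [map_subtype_ker_augLoc, D.prod_bot_eq_map_embLoc k le_rfl]
  congr 1
  exact inf_eq_right.mpr fun y _ => ⟨y, rfl⟩

/-- `T(Δ_{X̲,v̲}) = e(Δ_{X̲})`. [claim: Mochizuki2012, status: disputed] -/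
theorem map_subtype_peLoc_deltaXbar :
    Subgroup.map (G := (D.peLoc k ι).PiC) (D.PiLoc D.PiCK (localToGF F k ι)).subtype (D.peLoc k ι).DeltaXbar =
      D.geom.pe.DeltaXbar.map (D.embLoc k) := by
  rw [(D.peLoc k ι).map_deltaXbar_eq _ (D.PiLoc D.PiCK (localToGF F k ι)).subtype_injective,
    map_subtype_peLoc_PiX', map_subtype_peLoc_PiCbar, map_subtype_peLoc_deltaC,
    show D.PiCund = D.geom.pe.PiCbar.map D.geom.embK from rfl, ← PiLoc_inf,
    ← Subgroup.map_inf_eq _ _ _ D.geom.embK_injective, PiLoc_map_inf_map_embLoc_deltaC]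
  rfl

/-- `T(Δ_{C̲,v̲}) = e(Δ_{C̲})`. [claim: Mochizuki2012, status: disputed] -/
theorem map_subtype_peLoc_deltaCbar :
    Subgroup.map (G := (D.peLoc k ι).PiC) (D.PiLoc D.PiCK (localToGF F k ι)).subtype (D.peLoc k ι).DeltaCbar =
      D.geom.pe.DeltaCbar.map (D.embLoc k) := by
  rw [(D.peLoc k ι).map_deltaCbar_eq _ (D.PiLoc D.PiCK (localToGF F k ι)).subtype_injective,
    map_subtype_peLoc_PiCbar, map_subtype_peLoc_deltaC, show D.PiCund = D.geom.pe.PiCbar.map D.geom.embK from rfl,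
    PiLoc_map_inf_map_embLoc_deltaC]
  rfl

/-- `T(I_{x,v̲}) = e(I_x)` (inertia groups of cusps are geometric). [claim: Mochizuki2012, status: disputed] -/
theorem map_subtype_peLoc_inertia (c : (D.peLoc k ι).Cusp) :
    Subgroup.map (G := (D.peLoc k ι).PiC) (D.PiLoc D.PiCK (localToGF F k ι)).subtype ((D.peLoc k ι).inertia c) =
      (D.geom.pe.inertia c).map (D.embLoc k) := by
  rw [(D.peLoc k ι).map_inertia_eq _ (D.PiLoc D.PiCK (localToGF F k ι)).subtype_injective,
    map_subtype_peLoc_decomp, map_subtype_peLoc_deltaC, PiLoc_map_inf_map_embLoc_deltaC]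
  rfl

/-- `T(modLKer_v̲) = e(modLKer)` — `Ker(Δ_{X̲} ↠ Δ_{X̲}^{ab} ⊗ ℤ/l)` is geometric (commutators, `l`-th powers and
topological closures commute with the closed embeddings `T`, `e`). [claim: Mochizuki2012, status: disputed] -/
theorem map_subtype_peLoc_modLKer :
    Subgroup.map (G := (D.peLoc k ι).PiC) (D.PiLoc D.PiCK (localToGF F k ι)).subtype (D.peLoc k ι).modLKer =
      D.geom.pe.modLKer.map (D.embLoc k) := by
  rw [(D.peLoc k ι).map_modLKer_of_isClosedEmbedding _ (D.isClosedEmbedding_subtype_PiLoc_PiCK k ι),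
    D.geom.pe.map_modLKer_of_isClosedEmbedding _ (D.isClosedEmbedding_embLoc k), map_subtype_peLoc_deltaXbar]
  rfl

/-- `T(deltaEpsKer_v̲) = e(deltaEpsKer)` — `Ker(Δ_{X̲} ↠ Δ_ε)` is geometric (the cusps and their inertia groups are
unchanged). [claim: Mochizuki2012, status: disputed] -/
theorem map_subtype_peLoc_deltaEpsKer :
    Subgroup.map (G := (D.peLoc k ι).PiC) (D.PiLoc D.PiCK (localToGF F k ι)).subtype (D.peLoc k ι).deltaEpsKer =
      D.geom.pe.deltaEpsKer.map (D.embLoc k) := by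
  rw [(D.peLoc k ι).map_deltaEpsKer_eq, D.geom.pe.map_deltaEpsKer_eq, map_subtype_peLoc_modLKer]
  simp only [map_subtype_peLoc_inertia]
  rfl

end PeLoc

end InitialThetaData

end Literature.IUT.HodgeTheaters

end
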